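/-
Copyright (c) 2026. All rights reserved.
Released under Apache 2.0 license as described in the file LICENSE.
-/
import Literature.NumberTheory.Automorphic.MaximalOrderDiscFiveBrandtSetup
import Literature.NumberTheory.Automorphic.BrandtClassNumberOneNorms
import HarnessLib

/-!
# The norm form `a² + 2b² + 2c² + d² + ac − ad + 2bc + bd` of the maximal order of `(−2,−5 ∣ ℚ)` is universal
# (Voight, Exercise 17.10 (b)): the reduced norm `O₅ → ℕ` is onto, `6 ∣ r₅(n)`, `r₅(n) ≥ 6`, and `6·r₅(mn) = r₅(m)r₅(n)`

[tag: quaternion_algebra] [tag: quadratic_form] [tag: universal_form]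

Topic `NumberTheory/Automorphic`; THEOREMS ONLY (no definition, no named fact, no instance; net Literature debt `0`).
Lane `lit-hodgefound`, seat p12, gen 46 — tenth file of the series on the definite quaternion order of discriminant `5`; the
`D = 5` twin of `MaximalOrderDiscThreeNormsOnto`. Voight, Exercise 17.10 (b): «Show that the quadratic forms
`t² + tx + ty + tz + x² + xy + xz + 2y² − yz + 2z²`, … [the norm forms of the maximal orders of discriminant `5, 7, 13`] are
multiplicative and universal, i.e., represent all positive integers». Here for `D = 5` in the coordinates of
`O₅ = ℤ⟨1, i, (1+i+j)/2, (−2+i+k)/4⟩ ⊂ ℍ[ℚ,−2,−5]` (`MaximalOrderDiscFiveLattice.reducedNorm_mk`: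
`nrd = a² + 2b² + 2c² + d² + ac − ad + 2bc + bd`), by the quaternionic route: the reduced norm is multiplicative, `O₅` is a ring,
and every prime is a reduced norm from `O₅` (`MaximalOrderDiscFiveBrandtSetup.natCard_reducedNorm_prime`: `6(p + 1) > 0` elements
of norm `p ≠ 5`; `6` of norm `5`):

* §1 `exists_mem_reducedNorm_eq_prime` (every prime is `nrd x`, `x ∈ O₅`), **`exists_mem_reducedNorm_eq`** (EVERY `n ≥ 1` IS A
  REDUCED NORM FROM `O₅`), **`exists_form_eq`** (**every `n ∈ ℕ` is `a² + 2b² + 2c² + d² + ac − ad + 2bc + bd` with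
  `a, b, c, d ∈ ℤ`** — THE FORM IS UNIVERSAL), `exists_form_eq_int`, and in Voight's printed coordinates **`exists_voightForm_eq`** (every
  `n` is `t² + tx + ty + tz + x² + xy + xz + 2y² − yz + 2z²`; `voightForm_eq_form`: the unimodular substitution `(t,x,y,z) = (−a−c, b+d, c, −b)`); and since `r₅(n) = 6·T(n)₁₁` (`T(n)` the Brandt matrix of
  `O₅`), **`six_dvd_natCard_form`** (`6 ∣ r₅(n)`), **`six_le_natCard_form`** (`r₅(n) ≥ 6` for `n ≥ 1`) and
  **`six_mul_natCard_form_mul_of_coprime`** (`6·r₅(mn) = r₅(m)r₅(n)` for coprime `m, n`: `r₅/6` IS MULTIPLICATIVE — the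
  "multiplicative" clause of the exercise);
* §2 for EVERY Brandt setup `S : XiSetup 1 5` and every maximal order there: `xiSetup_exists_mem_reducedNorm_eq` (every `n ≥ 1`
  is a reduced norm from `S.O` — the tree's general `XiSetup.exists_mem_reducedNorm_eq_of_subsingleton_one` fed with
  `# Cls S.O = 1`), `exists_mem_reducedNorm_eq_of_isMaximalZOrder` (the same for every maximal `ℤ`-order of `ℍ[ℚ,−2,−5]`).

## Sources

* J. Voight, *Quaternion Algebras*, GTM 288 (2021), Exercise 17.10 (b) (quoted above), Thm. 25.4.1 (`D = 5`), §11.4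
  (Euler's identity / multiplicativity of the reduced norm). [cite: Voight2021, Exercise 17.10 (b); Thm. 25.4.1 (D = 5); §11.4]
* M. Eichler, LNM 320 (1973), Ch. II §6 Thm. 2 (18) and Cor. 1 (row sums: `r(n)/#O^×` multiplicative).
  [cite: Eichler1973, Ch. II §6 Thm. 2 (18) and Cor. 1]
* G. H. Hardy, E. M. Wright, *An Introduction to the Theory of Numbers*, 6th ed. (2008), §20.7–20.8 (the pattern: four squares
  from the Hurwitz order). [cite: HardyWright2008, §20.7–20.8]

## Scope (honest)

Theorems only — no definition, no named fact, no instance. Existence and divisibility only (the exact count `r₅(n)` for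
non-squarefree `5`-free parts awaits the Hecke recursion, cf. `MaximalOrderDiscFiveBrandtSetup`).
-/

open Quaternion
open scoped Pointwise
open Literature.NumberTheory.Automorphic.Brandt

namespace Literature.NumberTheory.Automorphic.MaxOrderDiscFive

/-! ## §1 `O₅`: every positive integer is a reduced norm; `6 ∣ r₅(n) ≥ 6`; `r₅/6` is multiplicative -/

section AtO

/-- **Every prime is a reduced norm from `O₅`** (`#{x ∈ O₅ : nrd x = p} = 6(p + 1)`, resp. `6` for `p = 5`, is positive).
[cite: Voight2021, Exercise 17.10 (b)] [cite: Eichler1973, Ch. II §6 Thm. 2 Cor. 1] -/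
theorem exists_mem_reducedNorm_eq_prime {p : ℕ} (hp : p.Prime) : ∃ x ∈ (Submodule.span ℤ (Set.range ![(⟨1, 0, 0, 0⟩ : ℍ[ℚ,-2,-5]), ⟨0, 1, 0, 0⟩, ⟨1/2, 1/2, 1/2, 0⟩, ⟨-1/2, 1/4, 0, 1/4⟩])), reducedNorm ℚ ℍ[ℚ,-2,-5] x = p := by
  have hne : Nonempty {x : ℍ[ℚ,-2,-5] // x ∈ (Submodule.span ℤ (Set.range ![(⟨1, 0, 0, 0⟩ : ℍ[ℚ,-2,-5]), ⟨0, 1, 0, 0⟩, ⟨1/2, 1/2, 1/2, 0⟩, ⟨-1/2, 1/4, 0, 1/4⟩])) ∧ reducedNorm ℚ ℍ[ℚ,-2,-5] x = p} := by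
    by_cases hp5 : p = 5
    · subst hp5
      have h := natCard_reducedNorm_five_pow 1
      rw [pow_one] at h
      exact (Nat.card_ne_zero.mp (by rw [h]; norm_num)).1
    · have h := natCard_reducedNorm_prime hp hp5
      exact (Nat.card_ne_zero.mp (by rw [h]; positivity)).1
  obtain ⟨⟨x, hx, hn⟩⟩ := hne
  exact ⟨x, hx, hn⟩

/-- **Every positive integer is a reduced norm from `O₅`**: `O₅` is closed under multiplication, `nrd` is multiplicative, and primes
(and `1`) are reduced norms. [cite: Voight2021, Exercise 17.10 (b) and §11.4] [cite: HardyWright2008, §20.7–20.8] -/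
theorem exists_mem_reducedNorm_eq {n : ℕ} (hn : 0 < n) : ∃ x ∈ (Submodule.span ℤ (Set.range ![(⟨1, 0, 0, 0⟩ : ℍ[ℚ,-2,-5]), ⟨0, 1, 0, 0⟩, ⟨1/2, 1/2, 1/2, 0⟩, ⟨-1/2, 1/4, 0, 1/4⟩])), reducedNorm ℚ ℍ[ℚ,-2,-5] x = n := by
  haveI := isQuaternionAlgebra
  induction n using Nat.recOnMul with
  | zero => exact absurd hn (lt_irrefl 0)
  | one => exact ⟨1, one_mem_lattice, by rw [reducedNorm_eq]; simp⟩
  | prime p hp => exact exists_mem_reducedNorm_eq_prime hp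
  | mul a b iha ihb =>
    obtain ⟨ha, hb⟩ : 0 < a ∧ 0 < b := by
      constructor <;> rcases Nat.eq_zero_or_pos a with rfl | ha <;> rcases Nat.eq_zero_or_pos b with rfl | hb <;>
        simp_all
    obtain ⟨x, hx, hxn⟩ := iha ha
    obtain ⟨y, hy, hyn⟩ := ihb hb
    exact ⟨x * y, mul_mem_lattice hx hy, by rw [reducedNorm_mul_holds ℚ ℍ[ℚ,-2,-5], hxn, hyn, Nat.cast_mul]⟩

/-- **VOIGHT, EXERCISE 17.10 (b) AT `D = 5`: every natural number is of the form `a² + 2b² + 2c² + d² + ac − ad + 2bc + bd` with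
`a, b, c, d ∈ ℤ`** (the norm form of the maximal order of discriminant `5` is universal). [cite: Voight2021, Exercise 17.10 (b)] -/
theorem exists_form_eq (n : ℕ) :
    ∃ a b c d : ℤ, a ^ 2 + 2 * b ^ 2 + 2 * c ^ 2 + d ^ 2 + a * c - a * d + 2 * b * c + b * d = n := by
  rcases Nat.eq_zero_or_pos n with rfl | hn
  · exact ⟨0, 0, 0, 0, by simp⟩
  · obtain ⟨x, hx, hxn⟩ := exists_mem_reducedNorm_eq hn
    obtain ⟨a, b, c, d, rfl⟩ := (mem_lattice_iff x).1 hx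
    rw [reducedNorm_mk] at hxn
    exact ⟨a, b, c, d, by exact_mod_cast hxn⟩

/-- Every integer `n ≥ 0` is of the form `a² + 2b² + 2c² + d² + ac − ad + 2bc + bd`. [cite: Voight2021, Exercise 17.10 (b)] -/
theorem exists_form_eq_int {n : ℤ} (hn : 0 ≤ n) :
    ∃ a b c d : ℤ, a ^ 2 + 2 * b ^ 2 + 2 * c ^ 2 + d ^ 2 + a * c - a * d + 2 * b * c + b * d = n := by
  obtain ⟨m, rfl⟩ := Int.eq_ofNat_of_zero_le hn
  exact exists_form_eq m

/-- The change of variables to Voight's printed coordinates: with `(t, x, y, z) = (−a − c, b + d, c, −b)` (unimodular, inverse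
`(a, b, c, d) = (−t − y, −z, y, x + z)`) one has `t² + tx + ty + tz + x² + xy + xz + 2y² − yz + 2z² = a² + 2b² + 2c² + d² + ac − ad + 2bc + bd`
— the two integral quadratic forms are equivalent. [cite: Voight2021, Exercise 17.10 (b)] -/
theorem voightForm_eq_form (a b c d : ℤ) :
    (-a - c) ^ 2 + (-a - c) * (b + d) + (-a - c) * c + (-a - c) * (-b) + (b + d) ^ 2 + (b + d) * c + (b + d) * (-b) +
        2 * c ^ 2 - c * (-b) + 2 * (-b) ^ 2 =
      a ^ 2 + 2 * b ^ 2 + 2 * c ^ 2 + d ^ 2 + a * c - a * d + 2 * b * c + b * d := by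
  ring

/-- **VOIGHT, EXERCISE 17.10 (b), AS PRINTED: the quadratic form `t² + tx + ty + tz + x² + xy + xz + 2y² − yz + 2z²` is universal** —
every natural number `n` is `t² + tx + ty + tz + x² + xy + xz + 2y² − yz + 2z²` for some `t, x, y, z ∈ ℤ` (it is the norm form of the
maximal order of discriminant `5` in Voight's basis, equivalent to ours by `voightForm_eq_form`). [cite: Voight2021, Exercise 17.10 (b)] -/
theorem exists_voightForm_eq (n : ℕ) :
    ∃ t x y z : ℤ, t ^ 2 + t * x + t * y + t * z + x ^ 2 + x * y + x * z + 2 * y ^ 2 - y * z + 2 * z ^ 2 = n := by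
  obtain ⟨a, b, c, d, h⟩ := exists_form_eq n
  exact ⟨-a - c, b + d, c, -b, by rw [← h]; ring⟩

/-- The integer solutions of `a² + 2b² + 2c² + d² + ac − ad + 2bc + bd = n` form a finite set (`a² ≤ 6n`, `b² ≤ 3n`, `c² ≤ n`,
`d² ≤ 2n`: all coordinates lie in `[−6n, 6n]`). [folklore] -/
private theorem finite_form (n : ℕ) :
    {v : ℤ × ℤ × ℤ × ℤ | v.1 ^ 2 + 2 * v.2.1 ^ 2 + 2 * v.2.2.1 ^ 2 + v.2.2.2 ^ 2 + v.1 * v.2.2.1 - v.1 * v.2.2.2 +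
      2 * v.2.1 * v.2.2.1 + v.2.1 * v.2.2.2 = n}.Finite := by
  refine (Finset.finite_toSet (Finset.Icc (-(6 * n : ℤ)) (6 * n) ×ˢ Finset.Icc (-(6 * n : ℤ)) (6 * n) ×ˢ
    Finset.Icc (-(6 * n : ℤ)) (6 * n) ×ˢ Finset.Icc (-(6 * n : ℤ)) (6 * n))).subset ?_
  rintro ⟨a, b, c, d⟩ h
  simp only [Set.mem_setOf_eq] at h
  simp only [Finset.coe_product, Finset.coe_Icc, Set.mem_prod, Set.mem_Icc]
  have hn : (0 : ℤ) ≤ n := Int.natCast_nonneg n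
  obtain ⟨ha, hb, hc, hd⟩ := sq_le_of_form_eq h
  have key : ∀ t : ℤ, t ^ 2 ≤ 6 * n → -(6 * (n : ℤ)) ≤ t ∧ t ≤ 6 * n := fun t ht => by
    constructor <;> nlinarith [sq_nonneg (t - 1), sq_nonneg (t + 1)]
  exact ⟨key a ha, key b (by linarith), key c (by linarith), key d (by linarith)⟩

/-- **`6 ∣ r₅(n)` for every `n ≥ 1`**: the number of representations of `n` by `a² + 2b² + 2c² + d² + ac − ad + 2bc + bd` is
`6·T(n)₁₁`, `T(n)` the Brandt matrix of `O₅` (the `6` units act freely). [cite: Eichler1973, Ch. II §6 Thm. 2 Cor. 1] [cite: Voight2021, Thm. 11.5.14 and Exercise 17.10] -/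
theorem six_dvd_natCard_form {n : ℕ} (hn : 0 < n) :
    6 ∣ Nat.card {v : ℤ × ℤ × ℤ × ℤ //
      v.1 ^ 2 + 2 * v.2.1 ^ 2 + 2 * v.2.2.1 ^ 2 + v.2.2.2 ^ 2 + v.1 * v.2.2.1 - v.1 * v.2.2.2 +
        2 * v.2.1 * v.2.2.1 + v.2.1 * v.2.2.2 = n} := by
  have c₀ : ClassSet (Submodule.span ℤ (Set.range ![(⟨1, 0, 0, 0⟩ : ℍ[ℚ,-2,-5]), ⟨0, 1, 0, 0⟩, ⟨1/2, 1/2, 1/2, 0⟩, ⟨-1/2, 1/4, 0, 1/4⟩])) := Quotient.mk (rightClassSetoid (Submodule.span ℤ (Set.range ![(⟨1, 0, 0, 0⟩ : ℍ[ℚ,-2,-5]), ⟨0, 1, 0, 0⟩, ⟨1/2, 1/2, 1/2, 0⟩, ⟨-1/2, 1/4, 0, 1/4⟩]))) ⟨(Submodule.span ℤ (Set.range ![(⟨1, 0, 0, 0⟩ : ℍ[ℚ,-2,-5]), ⟨0, 1, 0, 0⟩, ⟨1/2, 1/2, 1/2, 0⟩, ⟨-1/2, 1/4, 0, 1/4⟩])),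 lattice_mem_rightIdeals⟩
  have h := natCard_reducedNorm_eq_six_mul_matrix hn.ne' c₀
  rw [← natCard_form_eq_natCard_reducedNorm] at h
  have h6 : ((6 : ℕ) : ℤ) ∣ (Nat.card {v : ℤ × ℤ × ℤ × ℤ //
      v.1 ^ 2 + 2 * v.2.1 ^ 2 + 2 * v.2.2.1 ^ 2 + v.2.2.2 ^ 2 + v.1 * v.2.2.1 - v.1 * v.2.2.2 +
        2 * v.2.1 * v.2.2.1 + v.2.1 * v.2.2.2 = n} : ℤ) := ⟨_, h⟩
  exact Int.natCast_dvd_natCast.mp h6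

/-- **`r₅(n) ≥ 6` for every `n ≥ 1`**: every positive integer has at least `6` representations by
`a² + 2b² + 2c² + d² + ac − ad + 2bc + bd`. [cite: Voight2021, Exercise 17.10 (b) and Thm. 11.5.14] -/
theorem six_le_natCard_form {n : ℕ} (hn : 0 < n) :
    6 ≤ Nat.card {v : ℤ × ℤ × ℤ × ℤ //
      v.1 ^ 2 + 2 * v.2.1 ^ 2 + 2 * v.2.2.1 ^ 2 + v.2.2.2 ^ 2 + v.1 * v.2.2.1 - v.1 * v.2.2.2 +
        2 * v.2.1 * v.2.2.1 + v.2.1 * v.2.2.2 = n} := by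
  haveI : Finite {v : ℤ × ℤ × ℤ × ℤ //
      v.1 ^ 2 + 2 * v.2.1 ^ 2 + 2 * v.2.2.1 ^ 2 + v.2.2.2 ^ 2 + v.1 * v.2.2.1 - v.1 * v.2.2.2 +
        2 * v.2.1 * v.2.2.1 + v.2.1 * v.2.2.2 = n} := (finite_form n).to_subtype
  obtain ⟨a, b, c, d, h⟩ := exists_form_eq n
  haveI : Nonempty {v : ℤ × ℤ × ℤ × ℤ //
      v.1 ^ 2 + 2 * v.2.1 ^ 2 + 2 * v.2.2.1 ^ 2 + v.2.2.2 ^ 2 + v.1 * v.2.2.1 - v.1 * v.2.2.2 +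
        2 * v.2.1 * v.2.2.1 + v.2.1 * v.2.2.2 = n} := ⟨⟨⟨a, b, c, d⟩, h⟩⟩
  have hpos := Nat.card_pos (α := {v : ℤ × ℤ × ℤ × ℤ //
      v.1 ^ 2 + 2 * v.2.1 ^ 2 + 2 * v.2.2.1 ^ 2 + v.2.2.2 ^ 2 + v.1 * v.2.2.1 - v.1 * v.2.2.2 +
        2 * v.2.1 * v.2.2.1 + v.2.1 * v.2.2.2 = n})
  obtain ⟨k, hk⟩ := six_dvd_natCard_form hn
  rw [hk] at hpos ⊢
  have hk0 : 0 < k := Nat.pos_of_mul_pos_left hpos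
  omega

/-- **`r₅` is multiplicative up to the factor `6`: `6·r₅(mn) = r₅(m)·r₅(n)` for coprime `m, n ≥ 1`** (`r₅ = 6·T`, and the
`1 × 1` Brandt matrices of `O₅` satisfy `T(mn) = T(m)T(n)`) — the "multiplicative" clause of Voight's Exercise 17.10 (b).
[cite: Voight2021, Exercise 17.10 (b)] [cite: Eichler1973, Ch. II §6 Thm. 2 (18) and Cor. 1] -/
theorem six_mul_natCard_form_mul_of_coprime {m n : ℕ} (hm : 0 < m) (hn : 0 < n) (hmn : Nat.Coprime m n) :
    6 * Nat.card {v : ℤ × ℤ × ℤ × ℤ //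
        v.1 ^ 2 + 2 * v.2.1 ^ 2 + 2 * v.2.2.1 ^ 2 + v.2.2.2 ^ 2 + v.1 * v.2.2.1 - v.1 * v.2.2.2 +
          2 * v.2.1 * v.2.2.1 + v.2.1 * v.2.2.2 = (m * n : ℕ)} =
      Nat.card {v : ℤ × ℤ × ℤ × ℤ //
          v.1 ^ 2 + 2 * v.2.1 ^ 2 + 2 * v.2.2.1 ^ 2 + v.2.2.2 ^ 2 + v.1 * v.2.2.1 - v.1 * v.2.2.2 +
            2 * v.2.1 * v.2.2.1 + v.2.1 * v.2.2.2 = m} *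
        Nat.card {v : ℤ × ℤ × ℤ × ℤ //
          v.1 ^ 2 + 2 * v.2.1 ^ 2 + 2 * v.2.2.1 ^ 2 + v.2.2.2 ^ 2 + v.1 * v.2.2.1 - v.1 * v.2.2.2 +
            2 * v.2.1 * v.2.2.1 + v.2.1 * v.2.2.2 = n} := by
  have c₀ : ClassSet (Submodule.span ℤ (Set.range ![(⟨1, 0, 0, 0⟩ : ℍ[ℚ,-2,-5]), ⟨0, 1, 0, 0⟩, ⟨1/2, 1/2, 1/2, 0⟩, ⟨-1/2, 1/4, 0, 1/4⟩])) := Quotient.mk (rightClassSetoid (Submodule.span ℤ (Set.range ![(⟨1, 0, 0, 0⟩ : ℍ[ℚ,-2,-5]), ⟨0, 1, 0, 0⟩, ⟨1/2, 1/2, 1/2, 0⟩, ⟨-1/2, 1/4, 0, 1/4⟩]))) ⟨(Submodule.span ℤ (Set.range ![(⟨1, 0, 0, 0⟩ : ℍ[ℚ,-2,-5]), ⟨0, 1, 0, 0⟩, ⟨1/2, 1/2, 1/2, 0⟩, ⟨-1/2, 1/4, 0, 1/4⟩])), lattice_mem_rightIdeals⟩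
  have hmn' := natCard_reducedNorm_eq_six_mul_matrix (mul_pos hm hn).ne' c₀
  have hm' := natCard_reducedNorm_eq_six_mul_matrix hm.ne' c₀
  have hn' := natCard_reducedNorm_eq_six_mul_matrix hn.ne' c₀
  rw [← natCard_form_eq_natCard_reducedNorm] at hmn' hm' hn'
  rw [matrix_apply_mul_of_coprime hmn] at hmn'
  have h : (6 : ℤ) * (6 * (matrix (Submodule.span ℤ (Set.range ![(⟨1, 0, 0, 0⟩ : ℍ[ℚ,-2,-5]), ⟨0, 1, 0, 0⟩, ⟨1/2, 1/2, 1/2, 0⟩, ⟨-1/2, 1/4, 0, 1/4⟩])) m c₀ c₀ * matrix (Submodule.span ℤ (Set.range ![(⟨1, 0, 0, 0⟩ : ℍ[ℚ,-2,-5]), ⟨0, 1, 0, 0⟩, ⟨1/2, 1/2, 1/2, 0⟩, ⟨-1/2, 1/4, 0, 1/4⟩])) n c₀ c₀)) =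
      (6 * matrix (Submodule.span ℤ (Set.range ![(⟨1, 0, 0, 0⟩ : ℍ[ℚ,-2,-5]), ⟨0, 1, 0, 0⟩, ⟨1/2, 1/2, 1/2, 0⟩, ⟨-1/2, 1/4, 0, 1/4⟩])) m c₀ c₀) * (6 * matrix (Submodule.span ℤ (Set.range ![(⟨1, 0, 0, 0⟩ : ℍ[ℚ,-2,-5]), ⟨0, 1, 0, 0⟩, ⟨1/2, 1/2, 1/2, 0⟩, ⟨-1/2, 1/4, 0, 1/4⟩])) n c₀ c₀) := by ring
  rw [← hmn', ← hm', ← hn'] at h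
  exact_mod_cast h

/-- **`r₅(5n) = r₅(n)` and `6·r₅(mn) = r₅(m)r₅(n)` combined: `r₅(n)/6 = T(n)₁₁` is a multiplicative function of `n` with value `1`
at every power of `5`** — stated as `r₅(5ᵃ·m·n)·6 = r₅(m)·r₅(n)` for coprime `m, n ≥ 1`. [cite: Eichler1973, Ch. II §6 Thm. 2 (18), (20) and Cor. 1] -/
theorem six_mul_natCard_form_five_pow_mul_mul_of_coprime (a : ℕ) {m n : ℕ} (hm : 0 < m) (hn : 0 < n) (hmn : Nat.Coprime m n) :
    6 * Nat.card {v : ℤ × ℤ × ℤ × ℤ //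
        v.1 ^ 2 + 2 * v.2.1 ^ 2 + 2 * v.2.2.1 ^ 2 + v.2.2.2 ^ 2 + v.1 * v.2.2.1 - v.1 * v.2.2.2 +
          2 * v.2.1 * v.2.2.1 + v.2.1 * v.2.2.2 = (5 ^ a * (m * n) : ℕ)} =
      Nat.card {v : ℤ × ℤ × ℤ × ℤ //
          v.1 ^ 2 + 2 * v.2.1 ^ 2 + 2 * v.2.2.1 ^ 2 + v.2.2.2 ^ 2 + v.1 * v.2.2.1 - v.1 * v.2.2.2 +
            2 * v.2.1 * v.2.2.1 + v.2.1 * v.2.2.2 = m} *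
        Nat.card {v : ℤ × ℤ × ℤ × ℤ //
          v.1 ^ 2 + 2 * v.2.1 ^ 2 + 2 * v.2.2.1 ^ 2 + v.2.2.2 ^ 2 + v.1 * v.2.2.1 - v.1 * v.2.2.2 +
            2 * v.2.1 * v.2.2.1 + v.2.1 * v.2.2.2 = n} := by
  rw [← six_mul_natCard_form_mul_of_coprime hm hn hmn, Nat.cast_mul, Nat.cast_pow, Nat.cast_ofNat, natCard_form_five_pow_mul]

end AtO

/-! ## §2 Every Brandt setup of type `(1, 5)`; every maximal order of `ℍ[ℚ,−2,−5]` -/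

section Setup

/-- **In every Brandt setup `S` of type `(1, 5)` every positive integer is a reduced norm from the maximal order `S.O`** (`# Cls S.O = 1`,
`MaximalOrderDiscFiveBrandtSetup.xiSetup_subsingleton_classSet`, and the tree's general class-number-one norm theorem).
[cite: Voight2021, Exercise 17.10 (b) and Thm. 25.4.1 (D = 5)] [cite: HardyWright2008, §20.7–20.8] -/
theorem xiSetup_exists_mem_reducedNorm_eq (S : XiSetup 1 5) {n : ℕ} (hn : 0 < n) : ∃ x ∈ S.O, reducedNorm ℚ S.D x = n := by
  haveI := xiSetup_subsingleton_classSet S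
  exact S.exists_mem_reducedNorm_eq_of_subsingleton_one hn

/-- **Every maximal `ℤ`-order of `ℍ[ℚ,−2,−5]` represents every positive integer by its reduced norm** (it is `βO₅β⁻¹`-free: here
directly, as the Eichler order of the setup `(ℍ[ℚ,−2,−5], O')`). [cite: Voight2021, Exercise 17.10 (b) and §25.4] -/
theorem exists_mem_reducedNorm_eq_of_isMaximalZOrder {O' : Submodule ℤ ℍ[ℚ,-2,-5]} (hO' : IsMaximalZOrder O') {n : ℕ} (hn : 0 < n) :
    ∃ x ∈ O', reducedNorm ℚ ℍ[ℚ,-2,-5] x = n := by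
  haveI := isQuaternionAlgebra
  let S : XiSetup 1 5 :=
    { D := ℍ[ℚ,-2,-5]
      isTotallyDefinite := isTotallyDefinite
      squarefree := Nat.prime_five.prime.squarefree
      ramifiedPlaces_eq := ramifiedPlaces_eq
      O := O'
      isEichlerOrder := isEichlerOrder_iff_brandt.mp hO'.isEichlerOrder_one }
  exact xiSetup_exists_mem_reducedNorm_eq S hn

end Setup

end Literature.NumberTheory.Automorphic.MaxOrderDiscFive
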